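import Literature.NumberTheory.EllipticCurves.PAdicOneVariableSeriesFamilyOfCharacter
import Literature.NumberTheory.EllipticCurves.ProfiniteGroupDistributionDivisionAssembly
import HarnessLib

/-!
# `p = 2`, ABSTRACT TOWER, ABSTRACT SERIES: the moments of `i(b)` (II.4.7 (16)–(17)) and de Shalit II.4.12
# ASSEMBLED for an additive `[κ]`-equivariant family of `𝐃`-series — the β-agnostic composability certificate

Topic `NumberTheory/EllipticCurves`; namespace `Literature.NumberTheory.EllipticCurves`.

De Shalit, *Iwasawa theory of elliptic curves with complex multiplication* (1987), II.4.7 (16)–(17) and II.4.12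
(29)–(33).  Sequel of `PAdicOneVariableSeriesFamilyOfCharacter.lean` (`i := induce D` for a family
`φ : B → 𝒪̂_{F^nr}⟦X⟧`, `D_b = comap ((x⁻¹ D_{Θ(φ_b ∘ ϑ)})|_{ℤ₂ˣ}) ψ`, along an abstract tower `(G, 𝒰, κ)`).  The ONE
analytic input per `b` is the SOCKET (de Shalit's (11): `∫_{ℤ₂ˣ} x^{k+1} d(x⁻¹ D_{H_b}) = [S^0] D^k H_b`, a consequence of
the trace condition `𝒮 = 0` — `integral_restrictUnits_density_unitInv_pow_succ_of_colemanTrace_eq_zero` for the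
absolute, `…_of_relTraceTwo_eq_zero` for the relative Lubin–Tate tower), taken here as the hypothesis `hsock` in the
`Θ`-currency:

* §1 `integral_comap_indicator_character_pow_succ_seriesFamily` — **`∫_G 𝟙_{U_0} κ^{k+1} dD_b = [S^0] D^k H_b`**
  ((10)+(11) along the abstract tower: `integral_comap_restrictUnits_of_character_two` + `hsock`);
* §2 ★★★ `integral_induce_character_pow_succ_seriesFamily` — **the coset formula
  `∫_G κ(g)^{k+1} d i(b)(g) = Σ_{c ∈ G/U_0} κ(r_c)^{k+1} · [S^0] D^k H_{r_c⁻¹ • b}`** (II.4.7 (16)–(17));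
* §3 (`𝕜 = ℂ_[2]`) ★★★ `exists_twisting_μ_eq_forall_seriesFamily` — **II.4.12: ∃ E, ‖E‖ = C, `δ_{σ_𝔠,N𝔠} E = i(β_𝔠)` for
  every `𝔠`**, from units `β : I → B` with II.2.4 (ii) and the division hypotheses; and
  ★★★ `integral_character_pow_succ_of_twisting_eq_induce_seriesFamily` —
  **`∫_G κ^{k+1} dE = (κ(σ_𝔠)^{k+1} − N𝔠)⁻¹ · Σ_c κ(r_c)^{k+1} · [S^0] D^k H_{r_c⁻¹ • β_𝔠}`** ((29)↔(31) + (16)–(17)).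

Everything is proved; no named facts, no definitions, no instances (section-local instance attributes as in the
siblings), no `sorry`.

## References

* [deShalit1987] E. de Shalit, *Iwasawa theory of elliptic curves with complex multiplication* (1987),
  I.3.4 (10), I.3.5 (11) (p. 18), II.4.6 (14) (p. 59), II.4.7 (16)–(17) (p. 60), II.4.12 (29)–(33) (p. 66–69).
-/

noncomputable section

open MvPowerSeries Filter
open scoped Topology Classical

namespace Literature.NumberTheory.EllipticCurves

section SeriesFamilyMoments

open ValuativeRel IsLocalRing Field GroupDistribution
open Literature.NumberTheory.GaloisRepresentations Literature.NumberTheory.GaloisRepresentations.IsNonarchimedeanLocalField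
  Literature.NumberTheory.GaloisRepresentations.LubinTate Literature.NumberTheory.PAdicHodge

variable {F : Type} [Field F] [ValuativeRel F] [TopologicalSpace F] [IsNonarchimedeanLocalField F]

attribute [local instance] ltNormUniformSpace ltNormIsUniformAddGroup rk1 nF nE fintypeResidueField

variable (hq : residueFieldCard F = 2) (h2 : (valuation F).IsUniformizer (((2 : ℕ) : 𝒪[F]) : F))
  {σ₀ : absoluteGaloisGroup F} (hσ₀ : IsAbsArithFrob σ₀) (u : 𝒪[F]ˣ)
  {ε : (maxUnramifiedCompletion F)ˣ}
  (hε : maxUnramifiedCompletion.galAut F σ₀ (ε : maxUnramifiedCompletion F) =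
    algebraMap 𝒪[F] (maxUnramifiedCompletion F) (u : 𝒪[F]) * (ε : maxUnramifiedCompletion F))
variable {𝕜 : Type*} [NormedField 𝕜] [NormedAlgebra ℚ_[2] 𝕜] [IsUltrametricDist 𝕜] [CompleteSpace 𝕜]
  (Θ : UnrCoeff F →+* 𝕜) (e : 𝒪[F] →+* ℤ_[2])
  (hΘe : ∀ a : 𝒪[F], Θ (intToUnrCoeff F a) = padicIntCast 𝕜 (e a))
variable {G : Type*} [Group G] {𝒰 : SubgroupTower G} [∀ n, (𝒰.U n).Normal] (κ : G →* ℤ_[2]ˣ)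
  (hU : ∀ (n : ℕ) (g : G), g ∈ 𝒰.U n ↔ g ∈ 𝒰.U 0 ∧ PadicInt.toZModPow (n + 1) (κ g : ℤ_[2]) = 1)
  (hκ : ∀ (n : ℕ) (w : ℤ_[2]ˣ), PadicInt.toZModPow 1 (w : ℤ_[2]) = 1 →
    ∃ g ∈ 𝒰.U 0, PadicInt.toZModPow (n + 1) (κ g : ℤ_[2]) = PadicInt.toZModPow (n + 1) (w : ℤ_[2]))
  (ψ : (n : ℕ) → G ⧸ 𝒰.U n → ZMod (2 ^ (n + 1)))
  (hψ : ∀ (n : ℕ) (g : G), g ∈ 𝒰.U 0 → ψ n (𝒰.proj n g) = PadicInt.toZModPow (n + 1) (κ g : ℤ_[2]))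
variable {B : Type*} [CommMonoid B] [MulDistribMulAction G B] (φ : B → PowerSeries (UnrCoeff F))
  (hadd : ∀ b b' : B, φ (b * b') = φ b + φ b')
  (hgal : ∀ g ∈ 𝒰.U 0, ∀ b : B, ∃ a : 𝒪[F], (κ g : ℤ_[2]) = e a ∧
    φ (g • b) = PowerSeries.C (intToUnrCoeff F a) * PowerSeries.subst (homC' h2 u a) (φ b))
  {C : ℝ} (hC : ∀ (b : B) (k : ℕ), ‖PowerSeries.coeff k ((PowerSeries.subst (compSeriesC h2 hσ₀ u hε) (φ b)).map Θ)‖ ≤ C)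
  (hsock : ∀ (b : B) (k : ℕ), (restrictUnits ((invAmice₁ 2 ((PowerSeries.subst (compSeriesC h2 hσ₀ u hε) (φ b)).map Θ) (hC b)).density
          (ProfiniteTower.padicInt_isUniform 2) (unitInv 𝕜) uniformContinuous_unitInv norm_unitInv_le)).integral
      (fun x : ℤ_[2] ↦ padicIntCast 𝕜 (x ^ (k + 1))) = PowerSeries.constantCoeff (mahlerD^[k] ((PowerSeries.subst (compSeriesC h2 hσ₀ u hε) (φ b)).map Θ)))
  (hC0 : 0 ≤ C) (hCb : ∀ b : B, (GroupDistribution.comap (restrictUnits ((invAmice₁ 2 ((PowerSeries.subst (compSeriesC h2 hσ₀ u hε) (φ b)).map Θ) (hC b)).density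
          (ProfiniteTower.padicInt_isUniform 2) (unitInv 𝕜) uniformContinuous_unitInv norm_unitInv_le))
          ψ (𝒰.cellMap_trans κ ψ hψ) (𝒰.cellMap_injective κ hU ψ hψ) (𝒰.cellMap_fiberSurj κ hU hκ ψ hψ)).bound ≤ C)

/-! ### §1. (10)+(11) along the abstract tower -/

omit [CommMonoid B] [MulDistribMulAction G B] in
include hsock in
/-- **`∫_G 𝟙_{U_0}(g) κ(g)^{k+1} dD_b(g) = [S^0] D^k H_b`** (de Shalit (10): the pull-back integrates `κ^{k+1}` on
`U_0` to the `(k+1)`-st moment of `(x⁻¹D_{H_b})|_{ℤ₂ˣ}`, which is `[S^0]D^k H_b` by the socket (11)).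
[cite: deShalit1987, I.3.4 (10), I.3.5 (11) (p. 18)] -/
theorem integral_comap_indicator_character_pow_succ_seriesFamily (b : B) (k : ℕ) :
    (GroupDistribution.comap (restrictUnits ((invAmice₁ 2 ((PowerSeries.subst (compSeriesC h2 hσ₀ u hε) (φ b)).map Θ) (hC b)).density
          (ProfiniteTower.padicInt_isUniform 2) (unitInv 𝕜) uniformContinuous_unitInv norm_unitInv_le))
          ψ (𝒰.cellMap_trans κ ψ hψ) (𝒰.cellMap_injective κ hU ψ hψ) (𝒰.cellMap_fiberSurj κ hU hκ ψ hψ)).integral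
        (fun g ↦ (if 𝒰.proj 0 g = 1 then (1 : 𝕜) else 0) * padicIntCast 𝕜 ((κ g : ℤ_[2]) ^ (k + 1))) =
      PowerSeries.constantCoeff (mahlerD^[k] ((PowerSeries.subst (compSeriesC h2 hσ₀ u hε) (φ b)).map Θ)) := by
  exact (GroupDistribution.integral_comap_restrictUnits_of_character_two κ
    ((invAmice₁ 2 ((PowerSeries.subst (compSeriesC h2 hσ₀ u hε) (φ b)).map Θ) (hC b)).density
      (ProfiniteTower.padicInt_isUniform 2) (unitInv 𝕜) uniformContinuous_unitInv norm_unitInv_le)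
    hU hκ ψ hψ (uniformContinuous_padicIntCast_pow (𝕜 := 𝕜) (k + 1))).trans (hsock b k)

/-! ### §2. The coset formula for the moments of `i(b)` -/

include hsock in
/-- ★★★ **`∫_G κ(g)^{k+1} d i(b)(g) = Σ_{c ∈ G/U_0} κ(r_c)^{k+1} · [S^0] D^k H_{r_c⁻¹ • b}`**, `r_c = 𝒰.repr 0 c`
(de Shalit II.4.7 (16)–(17) for an abstract series family along an abstract tower).
[cite: deShalit1987, II.4.7 (16)–(17) (p. 60), I.3.5 (11) (p. 18)] -/
theorem integral_induce_character_pow_succ_seriesFamily (b : B) (k : ℕ) :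
    (GroupDistribution.induce (fun b ↦ (GroupDistribution.comap (restrictUnits ((invAmice₁ 2 ((PowerSeries.subst (compSeriesC h2 hσ₀ u hε) (φ b)).map Θ) (hC b)).density
          (ProfiniteTower.padicInt_isUniform 2) (unitInv 𝕜) uniformContinuous_unitInv norm_unitInv_le))
          ψ (𝒰.cellMap_trans κ ψ hψ) (𝒰.cellMap_injective κ hU ψ hψ) (𝒰.cellMap_fiberSurj κ hU hκ ψ hψ))) hC0 hCb b).integral
        (fun g ↦ padicIntCast 𝕜 ((κ g : ℤ_[2]) ^ (k + 1))) =
      ∑ c ∈ 𝒰.cells 0, padicIntCast 𝕜 ((κ (𝒰.repr 0 c) : ℤ_[2]) ^ (k + 1)) *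
        PowerSeries.constantCoeff (mahlerD^[k] ((PowerSeries.subst (compSeriesC h2 hσ₀ u hε) (φ ((𝒰.repr 0 c)⁻¹ • b))).map Θ)) := by
  rw [GroupDistribution.integral_induce _ hC0 hCb b
    (SubgroupTower.isTowerContinuous_padicIntCast_character_pow κ hU (k + 1))]
  refine Finset.sum_congr rfl (fun c _ ↦ ?_)
  have hfun : ∀ y : G, (if 𝒰.proj 0 y = 1 then (1 : 𝕜) else 0) *
      padicIntCast 𝕜 ((κ (𝒰.repr 0 c * y) : ℤ_[2]) ^ (k + 1)) =
      padicIntCast 𝕜 ((κ (𝒰.repr 0 c) : ℤ_[2]) ^ (k + 1)) *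
        ((if 𝒰.proj 0 y = 1 then (1 : 𝕜) else 0) * padicIntCast 𝕜 ((κ y : ℤ_[2]) ^ (k + 1))) := by
    intro y
    rw [map_mul, Units.val_mul, mul_pow, map_mul]
    ring
  rw [GroupDistribution.integral_congr _ hfun, GroupDistribution.integral_const_mul _ _
    (SubgroupTower.isTowerContinuous_indicator_mul_comp (T := (ProfiniteTower.padicInt 2).succ) ψ
      (Ψ := fun g ↦ (κ g : ℤ_[2])) (𝒰.proj_coe_character_eq_cellMap κ ψ hψ)
      (uniformContinuous_padicIntCast_pow (𝕜 := 𝕜) (k + 1))),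
    integral_comap_indicator_character_pow_succ_seriesFamily h2 hσ₀ u hε Θ κ hU hκ ψ hψ φ hC hsock _ k]

end SeriesFamilyMoments

/-! ### §3. De Shalit II.4.12 assembled for a series family (`𝕜 = ℂ_[2]`) -/

section SeriesFamilyDivision

open ValuativeRel IsLocalRing Field GroupDistribution
open Literature.NumberTheory.GaloisRepresentations Literature.NumberTheory.GaloisRepresentations.IsNonarchimedeanLocalField
  Literature.NumberTheory.GaloisRepresentations.LubinTate Literature.NumberTheory.PAdicHodge

variable {F : Type} [Field F] [ValuativeRel F] [TopologicalSpace F] [IsNonarchimedeanLocalField F]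

attribute [local instance] ltNormUniformSpace ltNormIsUniformAddGroup rk1 nF nE fintypeResidueField

variable (hq : residueFieldCard F = 2) (h2 : (valuation F).IsUniformizer (((2 : ℕ) : 𝒪[F]) : F))
  {σ₀ : absoluteGaloisGroup F} (hσ₀ : IsAbsArithFrob σ₀) (u : 𝒪[F]ˣ)
  {ε : (maxUnramifiedCompletion F)ˣ}
  (hε : maxUnramifiedCompletion.galAut F σ₀ (ε : maxUnramifiedCompletion F) =
    algebraMap 𝒪[F] (maxUnramifiedCompletion F) (u : 𝒪[F]) * (ε : maxUnramifiedCompletion F))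
variable (Θ : UnrCoeff F →+* ℂ_[2]) (e : 𝒪[F] →+* ℤ_[2])
  (hΘe : ∀ a : 𝒪[F], Θ (intToUnrCoeff F a) = padicIntCast ℂ_[2] (e a))
variable {G : Type*} [Group G] {𝒰 : SubgroupTower G} [∀ n, (𝒰.U n).Normal] (κ : G →* ℤ_[2]ˣ)
  (hU : ∀ (n : ℕ) (g : G), g ∈ 𝒰.U n ↔ g ∈ 𝒰.U 0 ∧ PadicInt.toZModPow (n + 1) (κ g : ℤ_[2]) = 1)
  (hκ : ∀ (n : ℕ) (w : ℤ_[2]ˣ), PadicInt.toZModPow 1 (w : ℤ_[2]) = 1 →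
    ∃ g ∈ 𝒰.U 0, PadicInt.toZModPow (n + 1) (κ g : ℤ_[2]) = PadicInt.toZModPow (n + 1) (w : ℤ_[2]))
  (ψ : (n : ℕ) → G ⧸ 𝒰.U n → ZMod (2 ^ (n + 1)))
  (hψ : ∀ (n : ℕ) (g : G), g ∈ 𝒰.U 0 → ψ n (𝒰.proj n g) = PadicInt.toZModPow (n + 1) (κ g : ℤ_[2]))
variable {B : Type*} [CommMonoid B] [MulDistribMulAction G B] (φ : B → PowerSeries (UnrCoeff F))
  (hadd : ∀ b b' : B, φ (b * b') = φ b + φ b')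
  (hgal : ∀ g ∈ 𝒰.U 0, ∀ b : B, ∃ a : 𝒪[F], (κ g : ℤ_[2]) = e a ∧
    φ (g • b) = PowerSeries.C (intToUnrCoeff F a) * PowerSeries.subst (homC' h2 u a) (φ b))
  {C : ℝ} (hC : ∀ (b : B) (k : ℕ), ‖PowerSeries.coeff k ((PowerSeries.subst (compSeriesC h2 hσ₀ u hε) (φ b)).map Θ)‖ ≤ C)
  (hsock : ∀ (b : B) (k : ℕ), (restrictUnits ((invAmice₁ 2 ((PowerSeries.subst (compSeriesC h2 hσ₀ u hε) (φ b)).map Θ) (hC b)).density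
          (ProfiniteTower.padicInt_isUniform 2) (unitInv ℂ_[2]) uniformContinuous_unitInv norm_unitInv_le)).integral
      (fun x : ℤ_[2] ↦ padicIntCast ℂ_[2] (x ^ (k + 1))) = PowerSeries.constantCoeff (mahlerD^[k] ((PowerSeries.subst (compSeriesC h2 hσ₀ u hε) (φ b)).map Θ)))
  (hC0 : 0 ≤ C) (hCb : ∀ b : B, (GroupDistribution.comap (restrictUnits ((invAmice₁ 2 ((PowerSeries.subst (compSeriesC h2 hσ₀ u hε) (φ b)).map Θ) (hC b)).density
          (ProfiniteTower.padicInt_isUniform 2) (unitInv ℂ_[2]) uniformContinuous_unitInv norm_unitInv_le))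
          ψ (𝒰.cellMap_trans κ ψ hψ) (𝒰.cellMap_injective κ hU ψ hψ) (𝒰.cellMap_fiberSurj κ hU hκ ψ hψ)).bound ≤ C)
variable {I : Type*} (hcomm : ∀ (n : ℕ) (x y : G), x * y * x⁻¹ * y⁻¹ ∈ 𝒰.U n)
  (β : I → B) (σ : I → G) (Nm : I → ℕ)
  (hrel : ∀ a c : I, σ c • β a * β c ^ Nm a = σ a • β c * β a ^ Nm c)

include hq hΘe hadd hgal hcomm hrel in
/-- ★★★ **De Shalit II.4.12 for a series family along an abstract tower**: with `i := induce D` and units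
`β : I → B` satisfying II.2.4 (ii), elements `σ : I → G`, norms `Nm : I → ℕ` and two indices `𝔞₁, 𝔞₂` with the
division hypotheses, **∃ E on `G` along `𝒰`, `‖E‖ = C`, with `δ_{σ_𝔠,N𝔠} E = i(β_𝔠)` levelwise for every `𝔠`**.
[cite: deShalit1987, II.4.12 (p. 66–69), II.4.6 (14) (p. 59), II.2.4 (ii) (p. 43)] -/
theorem exists_twisting_μ_eq_forall_seriesFamily {s : ℕ} (a₁ a₂ : I)
    (hσ₁ : σ a₁ ∈ 𝒰.U s) (hσ₂ : σ a₂ ∈ 𝒰.U s)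
    (hgen : ∀ m, s ≤ m → ∀ w ∈ 𝒰.U s, ∃ k : ℕ, 𝒰.proj m (σ a₁ ^ k) = 𝒰.proj m w)
    (hpow : ∀ n, s ≤ n → ∃ r : ℕ, orderOf (𝒰.proj n (σ a₁)) = 2 ^ r)
    (hunb : ∀ r : ℕ, ∃ m, 2 ^ r ∣ orderOf (𝒰.proj m (σ a₁)))
    (hN1 : 2 ≤ Nm a₁) (h4 : 4 ∣ Nm a₁ - 1) (hN12 : Nm a₂ = Nm a₁)
    (hτ : ∀ k, 0 < k → ∃ n, s ≤ n ∧ σ a₂ ^ k * (σ a₁ ^ k)⁻¹ ∉ 𝒰.U n) :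
    ∃ E : GroupDistribution 𝒰 ℂ_[2], E.bound = C ∧
      ∀ (c : I) (n : ℕ) (b : G ⧸ 𝒰.U n), (twisting (σ c) (Nm c : ℂ_[2]) E).μ n b =
        (GroupDistribution.induce (fun b ↦ (GroupDistribution.comap (restrictUnits ((invAmice₁ 2 ((PowerSeries.subst (compSeriesC h2 hσ₀ u hε) (φ b)).map Θ) (hC b)).density
          (ProfiniteTower.padicInt_isUniform 2) (unitInv ℂ_[2]) uniformContinuous_unitInv norm_unitInv_le))
          ψ (𝒰.cellMap_trans κ ψ hψ) (𝒰.cellMap_injective κ hU ψ hψ) (𝒰.cellMap_fiberSurj κ hU hκ ψ hψ))) hC0 hCb (β c)).μ n b := by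
  have h := exists_twisting_μ_eq_forall_of_units (p := 2) hcomm
    (fun b ↦ (GroupDistribution.induce (fun b ↦ (GroupDistribution.comap (restrictUnits ((invAmice₁ 2 ((PowerSeries.subst (compSeriesC h2 hσ₀ u hε) (φ b)).map Θ) (hC b)).density
          (ProfiniteTower.padicInt_isUniform 2) (unitInv ℂ_[2]) uniformContinuous_unitInv norm_unitInv_le))
          ψ (𝒰.cellMap_trans κ ψ hψ) (𝒰.cellMap_injective κ hU ψ hψ) (𝒰.cellMap_fiberSurj κ hU hκ ψ hψ))) hC0 hCb b))
    (fun g b n a ↦ induce_μ_smul_inv_seriesFamily hq h2 hσ₀ u hε Θ e hΘe κ hU hκ ψ hψ φ hgal hC hC0 hCb g b n a)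
    (fun b b' n a ↦ induce_μ_mul_seriesFamily h2 hσ₀ u hε Θ κ hU hκ ψ hψ φ hadd hC hC0 hCb b b' n a)
    β σ Nm hrel a₁ a₂ hσ₁ hσ₂ hgen hpow hunb hN1 (dvd_trans ⟨2, rfl⟩ h4) (fun _ ↦ h4) hN12 hτ
  simpa only [induce_bound] using h

include hsock in
/-- ★★★ **The moments of de Shalit's measure for a series family** ((29)↔(31) with (16)–(17)): if
`δ_{σ_𝔠,N𝔠} E = i(β_𝔠)` levelwise for every `𝔠` then, for every `𝔠` and `k` with `κ(σ_𝔠)^{k+1} ≠ N𝔠`,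
**`∫_G κ(g)^{k+1} dE(g) = (κ(σ_𝔠)^{k+1} − N𝔠)⁻¹ · Σ_{c ∈ G/U_0} κ(r_c)^{k+1} · [S^0] D^k H_{r_c⁻¹ • β_𝔠}`**.
[cite: deShalit1987, II.4.12 (29)–(31) (p. 67–69), II.4.7 (16)–(17) (p. 60)] -/
theorem integral_character_pow_succ_of_twisting_eq_induce_seriesFamily (E : GroupDistribution 𝒰 ℂ_[2])
    (hE : ∀ (c : I) (n : ℕ) (b : G ⧸ 𝒰.U n), (twisting (σ c) (Nm c : ℂ_[2]) E).μ n b =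
      (GroupDistribution.induce (fun b ↦ (GroupDistribution.comap (restrictUnits ((invAmice₁ 2 ((PowerSeries.subst (compSeriesC h2 hσ₀ u hε) (φ b)).map Θ) (hC b)).density
          (ProfiniteTower.padicInt_isUniform 2) (unitInv ℂ_[2]) uniformContinuous_unitInv norm_unitInv_le))
          ψ (𝒰.cellMap_trans κ ψ hψ) (𝒰.cellMap_injective κ hU ψ hψ) (𝒰.cellMap_fiberSurj κ hU hκ ψ hψ))) hC0 hCb (β c)).μ n b)
    (c : I) (k : ℕ) (hne : padicIntCast ℂ_[2] ((κ (σ c) : ℤ_[2]) ^ (k + 1)) ≠ (Nm c : ℂ_[2])) :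
    E.integral (fun g ↦ padicIntCast ℂ_[2] ((κ g : ℤ_[2]) ^ (k + 1))) =
      (padicIntCast ℂ_[2] ((κ (σ c) : ℤ_[2]) ^ (k + 1)) - (Nm c : ℂ_[2]))⁻¹ *
        ∑ c' ∈ 𝒰.cells 0, padicIntCast ℂ_[2] ((κ (𝒰.repr 0 c') : ℤ_[2]) ^ (k + 1)) *
          PowerSeries.constantCoeff (mahlerD^[k] ((PowerSeries.subst (compSeriesC h2 hσ₀ u hε) (φ ((𝒰.repr 0 c')⁻¹ • β c))).map Θ)) := by
  rw [integral_eq_of_units (p := 2) (fun b ↦ (GroupDistribution.induce (fun b ↦ (GroupDistribution.comap (restrictUnits ((invAmice₁ 2 ((PowerSeries.subst (compSeriesC h2 hσ₀ u hε) (φ b)).map Θ) (hC b)).density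
          (ProfiniteTower.padicInt_isUniform 2) (unitInv ℂ_[2]) uniformContinuous_unitInv norm_unitInv_le))
          ψ (𝒰.cellMap_trans κ ψ hψ) (𝒰.cellMap_injective κ hU ψ hψ) (𝒰.cellMap_fiberSurj κ hU hκ ψ hψ))) hC0 hCb b))
    β σ Nm E hE c (SubgroupTower.isTowerContinuous_padicIntCast_character_pow κ hU (k + 1))
    (fun x y ↦ by rw [map_mul, Units.val_mul, mul_pow, map_mul]) (by rw [map_one, Units.val_one, one_pow, map_one]) hne,
    integral_induce_character_pow_succ_seriesFamily h2 hσ₀ u hε Θ κ hU hκ ψ hψ φ hC hsock hC0 hCb (β c) k]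

end SeriesFamilyDivision

end Literature.NumberTheory.EllipticCurves

end
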